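import Summits.CriticalPhenomena.PercolationContinuityZ3.Theorems.PercNearOneGluingAdditiveGluingTripleTieReduction
import HarnessLib

/-!
# Crux `PercNearOneGluing.AdditiveGluing` (stmt-CriticalPhenomena-4576): pivotal RATES of internal pairs — Kozma–Nitzan's Lemma 4 in rate
# form, the common rate of a tied pair, and the tied-raise lemma TRL₃' from its φ-weighted pair form (Φ-TRL₃)

Support file (`--supports stmt-CriticalPhenomena-4576`, lead prim-png-lead-4576).  No definitions, no named facts, no sorries.

For a pair `e` and a vertex `x` the *pivotal rate* of `e` for `x ↔ b` is `g_x(e) := μ_{w[e↦1]}(x↔b) − μ_{w[e↦0]}(x↔b)` — the slope of the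
affine map `s ↦ μ_{w[e↦s]}(x↔b)` (one-bond decomposition `stub_oneBondDecomp_k15`).  This file records the rate calculus used by the
lead's zigzag reduction (crux dir evidence REDUCTION-TRL.md / KERNEL-PhiTRL3.md):
* `tiedRaise_gain_eq` — the gain from gluing `e` is `(1 − w e)·g_x(e)`;
* `tiedRaise_rate_le` — Kozma–Nitzan's Lemma 4 in rate form: for a pair `e = {a, y}` of vertices with `τ(a) ≤ τ(y)` and `w e < 1`,
  every vertex `o` has `g_o(e) ≤ g_a(e)` (from the landed `fullTie_gain_obs_le` = `knLemma4_pair_glued`);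
* `tiedRaise_rate_eq_of_tie` — a tied pair has a common rate: `τ(a) = τ(y)`, `w e < 1` ⇒ `g_a(e) = g_y(e)`;
* `tiedRaiseThreeInf_of_phi` — the registered stub `stub_tiedRaiseThreeInf_pl` (TRL₃': at a three-way tie, for nonnegative pair
  weights `x` giving the three relays a common rate `ρ`, the observer's rate is `≤ ρ`) follows from the registered stub
  `stub_phiTiedRaiseThree_pl` (Φ-TRL₃: the φ-weighted pair form, Kozma–Nitzan Lemma-2 weights) whenever the three internal weights are
  `< 1` and the observer's total φ-weight is positive: multiply the pair inequality for `e = {a_i,a_j}` by `x_e`, use the common rate of the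
  tied pair, sum over the three pairs and regroup by relay.
[cite: KozmaNitzan2024, Lemma 4 / eq. (8)–(9) (pp. 9–10), Lemma 2 (p. 6), Theorem 1 eq. (5)–(6) (p. 7)]
-/

namespace Summit.CriticalPhenomena.PercolationContinuityZ3.Theorems

open MeasureTheory Set Literature.Probability.LatticeModels Literature.Probability.Percolation

noncomputable section
open Classical

variable {n : ℕ}

/-- The gain of an event from gluing the pair `e` is `(1 − w e)` times its pivotal rate:
`μ_{w[e↦1]}(S) − μ_w(S) = (1 − w e)·(μ_{w[e↦1]}(S) − μ_{w[e↦0]}(S))`. [folklore] -/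
theorem tiedRaise_gain_eq (w : Sym2 (Fin n) → unitInterval) (e : Sym2 (Fin n)) (S : Set (BondConfig (Fin n))) :
    (prodBernoulli (Function.update w e 1)).real S - (prodBernoulli w).real S =
      (1 - (w e : ℝ)) * ((prodBernoulli (Function.update w e 1)).real S - (prodBernoulli (Function.update w e 0)).real S) := by
  have h := stub_oneBondDecomp_k15 n w e S
  rw [h]
  ring

/-- **Kozma–Nitzan Lemma 4 in rate form.**  For vertices `a ≠ y` with `τ(a) ≤ τ(y)` and `w s(a,y) < 1`, every vertex `o` gains
from the pair at most at the rate of its less reliable endpoint: `g_o(s(a,y)) ≤ g_a(s(a,y))`.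
[cite: KozmaNitzan2024, Lemma 4 / eq. (9) (pp. 9–10)] -/
theorem tiedRaise_rate_le (w : Sym2 (Fin n) → unitInterval) {a y : Fin n} (hay : a ≠ y) (o b : Fin n)
    (hle : (prodBernoulli w).real (openConn a b) ≤ (prodBernoulli w).real (openConn y b))
    (hw : (w s(a, y) : ℝ) < 1) :
    (prodBernoulli (Function.update w s(a, y) 1)).real (openConn o b) - (prodBernoulli (Function.update w s(a, y) 0)).real (openConn o b) ≤
      (prodBernoulli (Function.update w s(a, y) 1)).real (openConn a b) - (prodBernoulli (Function.update w s(a, y) 0)).real (openConn a b) := by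
  have hglue := fullTie_gain_obs_le w hay.symm o b hle
  rw [Sym2.eq_swap] at hglue
  rw [tiedRaise_gain_eq w s(a, y) (openConn o b), tiedRaise_gain_eq w s(a, y) (openConn a b)] at hglue
  have hpos : 0 < 1 - (w s(a, y) : ℝ) := by linarith
  exact le_of_mul_le_mul_left hglue hpos

/-- **A tied pair has a common rate**: `τ(a) = τ(y)`, `w s(a,y) < 1` ⇒ `g_a(s(a,y)) = g_y(s(a,y))`. [folklore] -/
theorem tiedRaise_rate_eq_of_tie (w : Sym2 (Fin n) → unitInterval) {a y : Fin n} (hay : a ≠ y) (b : Fin n)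
    (htie : (prodBernoulli w).real (openConn a b) = (prodBernoulli w).real (openConn y b))
    (hw : (w s(a, y) : ℝ) < 1) :
    (prodBernoulli (Function.update w s(a, y) 1)).real (openConn a b) - (prodBernoulli (Function.update w s(a, y) 0)).real (openConn a b) =
      (prodBernoulli (Function.update w s(a, y) 1)).real (openConn y b) - (prodBernoulli (Function.update w s(a, y) 0)).real (openConn y b) := by
  have h1 := tiedRaise_rate_le w hay y b htie.le hw
  have hw' : (w s(y, a) : ℝ) < 1 := by rw [Sym2.eq_swap]; exact hw
  have h2 := tiedRaise_rate_le w hay.symm a b htie.ge hw'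
  rw [Sym2.eq_swap] at h2
  exact le_antisymm (by linarith) (by linarith) |>.symm

/-- The real-arithmetic core of `tiedRaiseThreeInf_of_phi`: three pair inequalities with weights summing to a positive `S`,
common rates of the tied pairs and three equal total rates give the bound on the observer's total rate
(the weights need not even be nonnegative: the identity is exact). [folklore] -/
theorem tiedRaise_core_alg (Φ1 Φ2 Φ3 S13 S23 ρ x12 x13 x23 p12 p12' g12k g12o p13 p13' g13k g13o p23 p23' g23k g23o : ℝ)
    (hS : 0 < Φ1 + Φ2 + Φ3)
    (hS13 : S13 = Φ1 + Φ2 + Φ3) (hS23 : S23 = Φ1 + Φ2 + Φ3)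
    (hx12 : 0 ≤ x12) (hx13 : 0 ≤ x13) (hx23 : 0 ≤ x23)
    (P12 : Φ3 * (p12 - g12k) ≤ (Φ1 + Φ2 + Φ3) * (p12 - g12o))
    (P13 : Φ2 * (p13 - g13k) ≤ S13 * (p13 - g13o))
    (P23 : Φ1 * (p23 - g23k) ≤ S23 * (p23 - g23o))
    (c12 : p12 = p12') (c13 : p13 = p13') (c23 : p23 = p23')
    (hr1 : x12 * p12 + x13 * p13 + x23 * g23k = ρ)
    (hr2 : x12 * p12' + x13 * g13k + x23 * p23 = ρ)
    (hr3 : x12 * g12k + x13 * p13' + x23 * p23' = ρ) :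
    x12 * g12o + x13 * g13o + x23 * g23o ≤ ρ := by
  subst c12 c13 c23 hS13 hS23
  have Q12 := mul_le_mul_of_nonneg_left P12 hx12
  have Q13 := mul_le_mul_of_nonneg_left P13 hx13
  have Q23 := mul_le_mul_of_nonneg_left P23 hx23
  have key : (Φ1 + Φ2 + Φ3) * (x12 * g12o + x13 * g13o + x23 * g23o) ≤ (Φ1 + Φ2 + Φ3) * ρ := by
    have e1 : Φ1 * (x12 * p12 + x13 * p13 + x23 * g23k) = Φ1 * ρ := by rw [hr1]
    have e2 : Φ2 * (x12 * p12 + x13 * g13k + x23 * p23) = Φ2 * ρ := by rw [hr2]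
    have e3 : Φ3 * (x12 * g12k + x13 * p13 + x23 * p23) = Φ3 * ρ := by rw [hr3]
    nlinarith [Q12, Q13, Q23, e1, e2, e3]
  exact le_of_mul_le_mul_left key hS

/-- **TRL₃' from Φ-TRL₃** (both registered stubs of the crux), in the non-degenerate case: the three internal weights are `< 1` and the
observer's total φ-weight `Σ_l μ(o↔a_l ∩ N_l)·Π_{l'≠l} μ(N_{l'})` is positive.  See the file header for the proof.
[cite: KozmaNitzan2024, Lemma 4 (p. 9), Lemma 2 (p. 6)] -/
theorem tiedRaiseThreeInf_of_phi
    (hΦ : ∀ (n : ℕ) (w : Sym2 (Fin n) → unitInterval) (o b a₁ a₂ a₃ : Fin n), a₁ ≠ a₂ → a₁ ≠ a₃ → a₂ ≠ a₃ → (prodBernoulli w).real (openConn a₁ b) = (prodBernoulli w).real (openConn a₂ b) → (prodBernoulli w).real (openConn a₁ b) = (prodBernoulli w).real (openConn a₃ b) → (prodBernoulli w).real (openConn o a₃ ∩ ((openConn a₃ a₁)ᶜ ∩ (openConn a₃ a₂)ᶜ : Set (BondConfig (Fin n)))) * (prodBernoulli w).real ((openConn a₁ a₂)ᶜ ∩ (openConn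 a₁ a₃)ᶜ : Set (BondConfig (Fin n))) * (prodBernoulli w).real ((openConn a₂ a₁)ᶜ ∩ (openConn a₂ a₃)ᶜ : Set (BondConfig (Fin n))) * (((prodBernoulli (Function.update w s(a₁, a₂) 1)).real (openConn a₁ b) - (prodBernoulli (Function.update w s(a₁, a₂) 0)).real (openConn a₁ b)) - ((prodBernoulli (Function.update w s(a₁, a₂) 1)).real (openConn a₃ b) - (prodBernoulli (Function.update w s(a₁, a₂) 0)).real (openConn a₃ b))) ≤ ((prodBernoulli w).real (openConn o a₁ ∩ ((openConn a₁ a₂)ᶜ ∩ (openConn a₁ a₃)ᶜ : Set (BondConfig (Fin n)))) * (prodBernoulli w).real ((openConn a₂ a₁)ᶜ ∩ (openConn a₂ a₃)ᶜ : Set (BondConfig (Fin n))) * (prodBernoulli w).real ((openConn a₃ a₁)ᶜ ∩ (openConn a₃ a₂)ᶜ : Set (BondConfig (Fin n))) + (prodBernoulli w).real (openConn o a₂ ∩ ((openConn a₂ a₁)ᶜ ∩ (openConn a₂ a₃)ᶜ : Set (BondConfig (Fin n)))) * (prodBernoulli w).real ((openConn a₁ a₂)ᶜ ∩ (openConn a₁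 a₃)ᶜ : Set (BondConfig (Fin n))) * (prodBernoulli w).real ((openConn a₃ a₁)ᶜ ∩ (openConn a₃ a₂)ᶜ : Set (BondConfig (Fin n))) + (prodBernoulli w).real (openConn o a₃ ∩ ((openConn a₃ a₁)ᶜ ∩ (openConn a₃ a₂)ᶜ : Set (BondConfig (Fin n)))) * (prodBernoulli w).real ((openConn a₁ a₂)ᶜ ∩ (openConn a₁ a₃)ᶜ : Set (BondConfig (Fin n))) * (prodBernoulli w).real ((openConn a₂ a₁)ᶜ ∩ (openConn a₂ a₃)ᶜ : Set (BondConfig (Fin n)))) * (((prodBernoulli (Function.update w s(a₁, a₂) 1)).real (openConn a₁ b) - (prodBernoulli (Function.update w s(a₁, a₂) 0)).real (openConn a₁ b)) - ((prodBernoulli (Function.update w s(a₁, a₂) 1)).real (openConn o b) - (prodBernoulli (Function.update w s(a₁, a₂) 0)).real (openConn o b))))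
    (n : ℕ) (w : Sym2 (Fin n) → unitInterval) (o b a₁ a₂ a₃ : Fin n) (x₁₂ x₁₃ x₂₃ ρ : ℝ)
    (h12 : a₁ ≠ a₂) (h13 : a₁ ≠ a₃) (h23 : a₂ ≠ a₃)
    (ht12 : (prodBernoulli w).real (openConn a₁ b) = (prodBernoulli w).real (openConn a₂ b))
    (ht13 : (prodBernoulli w).real (openConn a₁ b) = (prodBernoulli w).real (openConn a₃ b))
    (hx12 : 0 ≤ x₁₂) (hx13 : 0 ≤ x₁₃) (hx23 : 0 ≤ x₂₃)
    (hr1 : x₁₂ * ((prodBernoulli (Function.update w s(a₁, a₂) 1)).real (openConn a₁ b) - (prodBernoulli (Function.update w s(a₁, a₂) 0)).real (openConn a₁ b)) + x₁₃ * ((prodBernoulli (Function.update w s(a₁, a₃) 1)).real (openConn a₁ b) - (prodBernoulli (Function.update w s(a₁, a₃) 0)).real (openConn a₁ b)) + x₂₃ * ((prodBernoulli (Function.update w s(a₂, a₃) 1)).real (openConn a₁ b) - (prodBernoulli (Function.update w s(a₂, a₃) 0)).real (openConn a₁ b)) = ρ) (hr2 : x₁₂ * ((prodBernoulli (Function.update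 w s(a₁, a₂) 1)).real (openConn a₂ b) - (prodBernoulli (Function.update w s(a₁, a₂) 0)).real (openConn a₂ b)) + x₁₃ * ((prodBernoulli (Function.update w s(a₁, a₃) 1)).real (openConn a₂ b) - (prodBernoulli (Function.update w s(a₁, a₃) 0)).real (openConn a₂ b)) + x₂₃ * ((prodBernoulli (Function.update w s(a₂, a₃) 1)).real (openConn a₂ b) - (prodBernoulli (Function.update w s(a₂, a₃) 0)).real (openConn a₂ b)) = ρ) (hr3 : x₁₂ * ((prodBernoulli (Function.update w s(a₁, a₂) 1)).real (openConn a₃ b) - (prodBernoulli (Function.update w s(a₁, a₂) 0)).real (openConn a₃ b)) + x₁₃ * ((prodBernoulli (Function.update w s(a₁, a₃) 1)).real (openConn a₃ b) - (prodBernoulli (Function.update w s(a₁, a₃) 0)).real (openConn a₃ b)) + x₂₃ * ((prodBernoulli (Function.update w s(a₂, a₃) 1)).real (openConn a₃ b) - (prodBernoulli (Function.update w s(a₂, a₃) 0)).real (openConn a₃ b)) = ρ)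
    (hw12 : (w s(a₁, a₂) : ℝ) < 1) (hw13 : (w s(a₁, a₃) : ℝ) < 1) (hw23 : (w s(a₂, a₃) : ℝ) < 1)
    (hS : 0 < ((prodBernoulli w).real (openConn o a₁ ∩ ((openConn a₁ a₂)ᶜ ∩ (openConn a₁ a₃)ᶜ : Set (BondConfig (Fin n)))) * (prodBernoulli w).real ((openConn a₂ a₁)ᶜ ∩ (openConn a₂ a₃)ᶜ : Set (BondConfig (Fin n))) * (prodBernoulli w).real ((openConn a₃ a₁)ᶜ ∩ (openConn a₃ a₂)ᶜ : Set (BondConfig (Fin n)))) + ((prodBernoulli w).real (openConn o a₂ ∩ ((openConn a₂ a₁)ᶜ ∩ (openConn a₂ a₃)ᶜ : Set (BondConfig (Fin n)))) * (prodBernoulli w).real ((openConn a₁ a₂)ᶜ ∩ (openConn a₁ a₃)ᶜ : Set (BondConfig (Fin n))) * (prodBernoulli w).real ((openConn a₃ a₁)ᶜ ∩ (openConn a₃ a₂)ᶜ : Set (BondConfig (Fin n)))) + ((prodBernoulli w).real (openConn o a₃ ∩ ((openConn a₃ a₁)ᶜ ∩ (openConn a₃ a₂)ᶜ : Set (BondConfig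 (Fin n)))) * (prodBernoulli w).real ((openConn a₁ a₂)ᶜ ∩ (openConn a₁ a₃)ᶜ : Set (BondConfig (Fin n))) * (prodBernoulli w).real ((openConn a₂ a₁)ᶜ ∩ (openConn a₂ a₃)ᶜ : Set (BondConfig (Fin n))))) :
    x₁₂ * ((prodBernoulli (Function.update w s(a₁, a₂) 1)).real (openConn o b) - (prodBernoulli (Function.update w s(a₁, a₂) 0)).real (openConn o b)) + x₁₃ * ((prodBernoulli (Function.update w s(a₁, a₃) 1)).real (openConn o b) - (prodBernoulli (Function.update w s(a₁, a₃) 0)).real (openConn o b)) + x₂₃ * ((prodBernoulli (Function.update w s(a₂, a₃) 1)).real (openConn o b) - (prodBernoulli (Function.update w s(a₂, a₃) 0)).real (openConn o b)) ≤ ρ := by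
  have hN1c : ((openConn a₁ a₃)ᶜ ∩ (openConn a₁ a₂)ᶜ : Set (BondConfig (Fin n))) =
      ((openConn a₁ a₂)ᶜ ∩ (openConn a₁ a₃)ᶜ : Set (BondConfig (Fin n))) := Set.inter_comm _ _
  have hN2c : ((openConn a₂ a₃)ᶜ ∩ (openConn a₂ a₁)ᶜ : Set (BondConfig (Fin n))) =
      ((openConn a₂ a₁)ᶜ ∩ (openConn a₂ a₃)ᶜ : Set (BondConfig (Fin n))) := Set.inter_comm _ _
  have hN3c : ((openConn a₃ a₂)ᶜ ∩ (openConn a₃ a₁)ᶜ : Set (BondConfig (Fin n))) =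
      ((openConn a₃ a₁)ᶜ ∩ (openConn a₃ a₂)ᶜ : Set (BondConfig (Fin n))) := Set.inter_comm _ _
  have ht23 : (prodBernoulli w).real (openConn a₂ b) = (prodBernoulli w).real (openConn a₃ b) := by rw [← ht12, ht13]
  have P12 := hΦ n w o b a₁ a₂ a₃ h12 h13 h23 ht12 ht13
  have P13 := hΦ n w o b a₁ a₃ a₂ h13 h12 h23.symm ht13 ht12
  have P23 := hΦ n w o b a₂ a₃ a₁ h23 h12.symm h13.symm ht23 ht12.symm
  rw [hN1c] at P13
  rw [hN2c, hN3c] at P23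
  have c12 := tiedRaise_rate_eq_of_tie w h12 b ht12 hw12
  have c13 := tiedRaise_rate_eq_of_tie w h13 b ht13 hw13
  have c23 := tiedRaise_rate_eq_of_tie w h23 b ht23 hw23
  refine tiedRaise_core_alg _ _ _ _ _ _ _ _ _ _ _ _ _ _ _ _ _ _ _ _ _ hS ?_ ?_ hx12 hx13 hx23 P12 P13 P23 c12 c13 c23 hr1 hr2 hr3
  · ring
  · ring

end

end Summit.CriticalPhenomena.PercolationContinuityZ3.Theorems
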